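import Summits.ResolutionOfSingularities.ResolutionOfSingularities.Theorems.FrobeniusClosingSteerRankFourExitTwo
import Summits.ResolutionOfSingularities.ResolutionOfSingularities.Theorems.FrobeniusClosingSteerJacobianThinness
import HarnessLib

/-!
# Crux `Steer` (stmt-ResolutionOfSingularities-16345), chain W4.1, p = 2 σ-residual, LOW half: the CRITICAL SURFACE IS
# FOLLOWED by a non-exiting point step (C5′ = B9) (Theses-free, def-free)

OURS (campaign `res-hironaka`, rung L ★L-G4, slot W4.1; res-L0-w41-idea-3's card `hyperbolic-splitting-p2` v2/v3, piece (C5)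
`CriticalSurfaceFollowed`, in res-L0-w41-tri-3 g3's REPAIRED form (C5′) `CriticalSurfaceFollowedDim4`
(`L/res-L0-w41-tri-3/Scratch-g3.lean` 9e9cf3bbe5d46950 §3: the source dimension pinned to `4` — below dimension `4` the
binder `Ideal.span {l₁, l₂, l₃, l₄} = 𝔪` admits a zero form and (C5) is false as typed, TRIAGE.md row R-F); res-L0-w41-plan-1
RULING 16d / 18d «C5′ → res-type-072». Replaces the role of no printed item; NOT a statement of the manuscript under review
[claim: Hironaka2017, status: under-review]; AI review is weaker than expert review.)

## Statement (`CriticalSurface.criticalSurfaceFollowed_two`)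

Characteristic `2`. Let `R ⊂ R'` be a quadratic transform along the valuation ring `O` of `K` (`IsQuadraticTransformAlong`)
of REGULAR local subrings of dimension `4`, `R` dominated by `O`, residues of `R` and of `R'` squares; `x` an exceptional
parameter of `R` (`SteerRankThinness.IsExcParam`: non-zero, of value `< 1`, maximal among such); `s = x·s' + G` a strict step
of radicands (`s² ∈ R`, `s'² ∈ R'`, `G ∈ R`); and let `s²` be in LOW SHAPE, `s² − g² = l₁ l₂ + c` with `c ∈ 𝔪³` and
`(l₁, l₂, l₃, l₄) = 𝔪`. If the next stage is CLEANABLE — `s'² − γ² ∈ 𝔪'²` for some `γ ∈ R'`, i.e. `T² = s'²` is singular at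
the closed point of `R'` (res-type-082's criterion p503226), the run does not exit — then `l₁/x, l₂/x ∈ 𝔪_{R'}`: the new centre
lies on the strict transform of the critical surface `Σ₂` (whose tangent plane is the polar radical `V(l̄₁, l̄₂)`).

Binders: tri-3's (C5′) VERBATIM plus the four binders res-L0-w41-stub-3 needed for the sibling one-step lemma B7
(`RankFourExit`, HOME/STATUS 2026-08-27T08:15:49Z «BINDER DELTAS»): `hdom : SubringDominates R O`, `hdim' : ringKrullDim R' = 4`,
`hperf` / `hperf'` (residues of `R`, `R'` are squares) — all automatic on the chain (`CoreDatum`: perfect ground field, residue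
fields algebraic over it; members `locAtCentre _ O`; K-T1 p503921 dimension `4`).

## Proof (res-L0-w41-tri-3's hand proof, run on res-L0-w41-stub-3's cotangent machinery for B7 — no re-proof of B7)

Let `x₀` be the chart generator (`R' = (R[𝔪/x₀])_{𝔪_O}`), `v_j := l_j/x₀ ∈ R'`, `δ : R' → 𝔪'/𝔪'²` the characteristic-2
cotangent derivation (`CotangentDerivation.exists_cotangentDerivation`: additive, Leibniz, kills squares). In characteristic `2`,
`x²·s'² = s² − G² = (g − G)² + l₁ l₂ + c`; the 𝔪-adic order is non-negative on `R'` (`QuadraticStep.mul_pow_mem_maximalIdeal_pow`),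
so `g − G ∈ 𝔪` and in `R'`:  `s'²·(x/x₀)² = ((g − G)/x₀)² + v₁ v₂ + x₀·(c/x₀³)`. Cleanable ⇒ `δ(s'²) = 0`, whence
(R1) `v̄₂·δv₁ + v̄₁·δv₂ + r̄·δx₀ = 0`. From `x₀ = Σ c_j l_j + m₂` (`m₂ ∈ 𝔪²`): `1 = Σ c_j v_j + x₀·(m₂/x₀²)`, so
(R0) `Σ c̄_j·δv_j + μ·δx₀ = 0` with `c̄ ≠ 0` (`x₀ ∉ 𝔪²`) and `Σ c̄_j v̄_j = 1`. The five classes `δx₀, δv_j` span the `4`-space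
`𝔪'/𝔪'²` (`RankFourExit.span_delta_eq_top`), so (R1) is a multiple `t` of (R0) (`CotangentDerivation.exists_smul_of_two_relations`):
`(v̄₂, v̄₁, 0, 0) = t·c̄`. Pairing with `v̄`: `2 v̄₁ v̄₂ = 0 = t·Σ c̄_j v̄_j = t`. Hence `v̄₁ = v̄₂ = 0`, i.e. `l_j/x₀ ∈ 𝔪'`, and
`l_j/x = (l_j/x₀)·(x₀/x)` with `x₀/x ∈ R'` (`QuadraticStep.div_mem_of_isQuadraticTransformAlong`). No rationality of the blown-up
point is used. [cite: Matsumura1987, Thm. 14.2] [folklore]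

Consumers: idea-3's LOW assembly §σ2.23 `lowOrderTailConclTwoN_of_lipman` (RULING 18c), piece `CriticalSurfaceFollowedDim4Two`.
Imports res-L0-w41-stub-3's B7 stack (`…RankFourExitTwo` ⊇ `…RankFourExitSpan`, `…CotangentDerivationTwo`, `…CotangentQuadratic`,
`…QuadraticStepLemmas`) and `…JacobianThinness` (`IsExcParam`).
-/

noncomputable section

-- `Summit.<S>.<S>.…` duplicates the summit name by design (single-problem summit).
set_option linter.dupNamespace false

namespace Summit.ResolutionOfSingularities.ResolutionOfSingularities.Theorems.SwitchingDichotomy.CriticalSurface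

open IsLocalRing Module Literature.AlgebraicGeometry.Resolution
open Summit.ResolutionOfSingularities.ResolutionOfSingularities.Theorems.SwitchingDichotomy
open Summit.ResolutionOfSingularities.ResolutionOfSingularities.Theorems.SteerRankThinness (IsExcParam)

-- `K : Type` (universe `0`) as in the skeleton of record and tri-3's typed (C5′).
variable {K : Type} [Field K]

/-! ## Bookkeeping -/

/-- If `l₁, l₂, l₃, l₄` generate the maximal ideal of a Noetherian local ring, their classes span the cotangent space
`𝔪/𝔪²` (bookkeeping over Mathlib's `CotangentSpace.span_image_eq_top_iff`). [folklore] -/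
theorem span_toCotangent_four_eq_top {S : Type} [CommRing S] [IsLocalRing S] [IsNoetherianRing S]
    (l₁ l₂ l₃ l₄ : S) (hspan : Ideal.span {l₁, l₂, l₃, l₄} = maximalIdeal S)
    (h₁ : l₁ ∈ maximalIdeal S) (h₂ : l₂ ∈ maximalIdeal S) (h₃ : l₃ ∈ maximalIdeal S) (h₄ : l₄ ∈ maximalIdeal S) :
    Submodule.span (ResidueField S)
      (Set.range fun j => (maximalIdeal S).toCotangent
        ((![⟨l₁, h₁⟩, ⟨l₂, h₂⟩, ⟨l₃, h₃⟩, ⟨l₄, h₄⟩] : Fin 4 → maximalIdeal S) j)) = ⊤ := by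
  classical
  set u : Fin 4 → maximalIdeal S := ![⟨l₁, h₁⟩, ⟨l₂, h₂⟩, ⟨l₃, h₃⟩, ⟨l₄, h₄⟩] with hu
  have hrange : (Set.range fun j => (maximalIdeal S).toCotangent (u j)) =
      (maximalIdeal S).toCotangent '' Set.range u := by
    rw [← Set.range_comp]; rfl
  rw [hrange, CotangentSpace.span_image_eq_top_iff]
  -- `span_S (range u) = ⊤` in `↥𝔪`: compare images under the (injective) subtype
  apply Submodule.map_injective_of_injective (maximalIdeal S).injective_subtype
  rw [Submodule.map_span, Submodule.map_top, Submodule.range_subtype]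
  have himg : (maximalIdeal S).subtype '' Set.range u = ({l₁, l₂, l₃, l₄} : Set S) := by
    ext y
    simp only [Set.mem_image, Set.mem_range, Set.mem_insert_iff, Set.mem_singleton_iff, hu]
    constructor
    · rintro ⟨_, ⟨j, rfl⟩, rfl⟩
      fin_cases j <;> simp
    · rintro (rfl | rfl | rfl | rfl)
      · exact ⟨u 0, ⟨0, rfl⟩, rfl⟩
      · exact ⟨u 1, ⟨1, rfl⟩, rfl⟩
      · exact ⟨u 2, ⟨2, rfl⟩, rfl⟩
      · exact ⟨u 3, ⟨3, rfl⟩, rfl⟩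
  rw [himg]
  exact hspan

/-! ## (C5′) The critical surface is followed -/

/-- **(C5′ = B9) The critical surface is followed by a non-exiting point step** (res-L0-w41-idea-3's `CriticalSurfaceFollowed` in
res-L0-w41-tri-3's repaired form `CriticalSurfaceFollowedDim4`, plus stub-3's four B7 binders `hdom`, `hdim'`, `hperf`, `hperf'`):
characteristic `2`, `R ⊂ R'` a quadratic transform along `O` of regular local rings of dimension `4` (`R` dominated by `O`, residues
squares), `x` an exceptional parameter of `R`, `s = x·s' + G` a strict step with `s²` in LOW SHAPE `s² − g² = l₁ l₂ + c`
(`c ∈ 𝔪³`, `(l₁, l₂, l₃, l₄) = 𝔪`). If some cleaning `s'² − γ²` lies in `𝔪_{R'}²` (the step does not exit), then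
`l₁/x, l₂/x ∈ 𝔪_{R'}` — the next centre lies on the strict transform of `Σ₂`. (The binder `_hdim : dim R = 4` of the typed
statement is not used: only `dim R' = 4` and the four generators of `𝔪_R` enter.) OURS. [cite: Matsumura1987, Thm. 14.2]
[folklore] -/
theorem criticalSurfaceFollowed_two [CharP K 2] (O : ValuationSubring K) (R R' : Subring K) [IsRegularLocalRing R]
    [IsRegularLocalRing R'] (_hdim : ringKrullDim R = 4) (hdim' : ringKrullDim R' = 4)
    (hQT : IsQuadraticTransformAlong O R R') (hdom : SubringDominates R O.toSubring)
    (hperf : ∀ a : R, ∃ b : R, a - b ^ 2 ∈ maximalIdeal R)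
    (hperf' : ∀ a : R', ∃ b : R', a - b ^ 2 ∈ maximalIdeal R')
    (s s' x G : K) (hs : s ^ 2 ∈ R) (hs' : s' ^ 2 ∈ R') (hx : IsExcParam O R x) (hG : G ∈ R)
    (hstep : s = x * s' + G)
    (g l₁ l₂ l₃ l₄ c : R) (hf : (⟨s ^ 2, hs⟩ : R) - g ^ 2 = l₁ * l₂ + c) (hc : c ∈ maximalIdeal R ^ 3)
    (hspan : Ideal.span {l₁, l₂, l₃, l₄} = maximalIdeal R)
    (hnext : ∃ γ : R', (⟨s' ^ 2, hs'⟩ : R') - γ ^ 2 ∈ maximalIdeal R' ^ 2) :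
    ∃ (h₁ : (l₁ : K) / x ∈ R') (h₂ : (l₂ : K) / x ∈ R'),
      (⟨(l₁ : K) / x, h₁⟩ : R') ∈ maximalIdeal R' ∧ (⟨(l₂ : K) / x, h₂⟩ : R') ∈ maximalIdeal R' := by
  classical
  -- ### setup: domination, the chart generator `x₀`, the exceptional parameter `x`
  have hRO : R ≤ O.toSubring := hQT.source_le
  have hR₁O : R' ≤ O.toSubring := hQT.target_le
  have hRR₁ : R ≤ R' := hQT.le
  have hdom₁ : SubringDominates R' O.toSubring := hQT.dominated
  have hval : ∀ a : R, a ∈ maximalIdeal R ↔ O.valuation (a : K) < 1 :=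
    (subringDominates_valuationSubring_iff hRO).mp hdom
  have hval₁ : ∀ a : R', a ∈ maximalIdeal R' ↔ O.valuation (a : K) < 1 :=
    (subringDominates_valuationSubring_iff hR₁O).mp hdom₁
  obtain ⟨_, x₀, hx₀m, hx₀0, hx₀max, hR₁⟩ := hQT.exists_eq_locAtCentre
  have hvx₀ : O.valuation (x₀ : K) < 1 := (hval x₀).mp hx₀m
  have hx₀K : (x₀ : K) ≠ 0 := fun h => hx₀0 (Subtype.ext h)
  have hmax' : ∀ y ∈ R, O.valuation y < 1 → O.valuation y ≤ O.valuation (x₀ : K) :=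
    fun y hy hvy => hx₀max ⟨y, hy⟩ ((hval ⟨y, hy⟩).mpr hvy)
  obtain ⟨hxR, hx0, hvx, hxmax⟩ := hx
  haveI : CharP (ResidueField R') 2 := RankFourExit.charP_residueField_two R'
  have h2K : (2 : K) = 0 := by
    have := CharP.cast_eq_zero K 2
    simpa using this
  have h2κ : (2 : ResidueField R') = 0 := by
    have := CharP.cast_eq_zero (ResidueField R') 2
    simpa using this
  have hB : blowupRing R (x₀ : K) ≤ R' := by rw [hR₁]; exact le_locAtCentre _ O
  have h4' : finrank (ResidueField R') (CotangentSpace R') = 4 :=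
    RankFourExit.finrank_cotangentSpace_eq_four R' hdim'
  -- the `l_j` lie in `𝔪_R`
  have hl : ∀ y ∈ ({l₁, l₂, l₃, l₄} : Set R), y ∈ maximalIdeal R := fun y hy =>
    hspan ▸ Ideal.subset_span hy
  have hl₁ : l₁ ∈ maximalIdeal R := hl _ (by simp)
  have hl₂ : l₂ ∈ maximalIdeal R := hl _ (by simp)
  have hl₃ : l₃ ∈ maximalIdeal R := hl _ (by simp)
  have hl₄ : l₄ ∈ maximalIdeal R := hl _ (by simp)
  -- the lifted cotangent basis `u = (l₁, l₂, l₃, l₄)` of `R`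
  let u : Fin 4 → maximalIdeal R := ![⟨l₁, hl₁⟩, ⟨l₂, hl₂⟩, ⟨l₃, hl₃⟩, ⟨l₄, hl₄⟩]
  have hu : Submodule.span (ResidueField R)
      (Set.range fun j => (maximalIdeal R).toCotangent (u j)) = ⊤ :=
    span_toCotangent_four_eq_top l₁ l₂ l₃ l₄ hspan hl₁ hl₂ hl₃ hl₄
  have hu0 : ((u 0 : maximalIdeal R) : R) = l₁ := rfl
  have hu1 : ((u 1 : maximalIdeal R) : R) = l₂ := rfl
  -- `ψ : R → κ'` and its kernel
  let ψ : R →+* ResidueField R' := (residue R').comp (Subring.inclusion hRR₁)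
  have hψ : ∀ r : R, ψ r = 0 → r ∈ maximalIdeal R := by
    intro r hr
    have h1 : Subring.inclusion hRR₁ r ∈ maximalIdeal R' := (residue_eq_zero_iff _).mp hr
    exact (hval r).mpr ((hval₁ _).mp h1)
  -- ### the players in `R'`
  have hvmem : ∀ j, ((u j : R) : K) / x₀ ∈ R' := fun j =>
    QuadraticStep.div_mem_of_isQuadraticTransformAlong hQT hdom x₀.2 hx₀K hvx₀ hmax' (u j : R).2
      ((hval _).mp (u j).2)
  let v : Fin 4 → R' := fun j => ⟨((u j : R) : K) / x₀, hvmem j⟩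
  have hv : ∀ j, (v j : K) = (u j : R) / x₀ := fun j => rfl
  have hv0 : (v 0 : K) = (l₁ : K) / x₀ := by rw [hv, hu0]
  have hv1 : (v 1 : K) = (l₂ : K) / x₀ := by rw [hv, hu1]
  let x₀' : R' := ⟨x₀, hRR₁ x₀.2⟩
  have hx₀' : (x₀' : K) = x₀ := rfl
  have hres0 : residue R' x₀' = 0 := by
    rw [residue_eq_zero_iff]
    exact QuadraticStep.mem_maximalIdeal_of_valuation_lt_one hR₁O x₀' hvx₀
  have hex : x / x₀ ∈ R' :=
    QuadraticStep.div_mem_of_isQuadraticTransformAlong hQT hdom x₀.2 hx₀K hvx₀ hmax' hxR hvx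
  let ex : R' := ⟨x / x₀, hex⟩
  have hr₃ : (c : K) / (x₀ : K) ^ 3 ∈ R' := hB (QuadraticStep.div_pow_mem_blowupRing x₀ hc)
  let r₃ : R' := ⟨(c : K) / (x₀ : K) ^ 3, hr₃⟩
  let f₁ : R' := ⟨s' ^ 2, hs'⟩
  -- the translate defect `d = g − G ∈ R`
  set d : R := g - ⟨G, hG⟩ with hd
  -- the key identity in `K`: `x² s'² = d² + l₁ l₂ + c`
  have hsK : s ^ 2 - (g : K) ^ 2 = l₁ * l₂ + c := by
    have := congrArg (fun z : R => (z : K)) hf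
    push_cast at this
    exact this
  have hkeyK : x ^ 2 * s' ^ 2 = (d : K) ^ 2 + l₁ * l₂ + c := by
    have hsq : x ^ 2 * s' ^ 2 = s ^ 2 + G ^ 2 := by
      rw [hstep]; linear_combination (-(x * s' * G + G ^ 2)) * h2K
    have hdK : (d : K) = (g : K) - G := by rw [hd]; push_cast; ring
    rw [hsq, hdK]
    linear_combination hsK + ((g : K) * G) * h2K
  -- `d² = x² s'² − l₁ l₂ − c`
  have hd2 : (d : K) ^ 2 = x ^ 2 * s' ^ 2 - l₁ * l₂ - c := by linear_combination -hkeyK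
  -- `d²/x₀² ∈ R'`, hence `d ∈ 𝔪_R` (the 𝔪-adic order is non-negative on `R'`), hence `d/x₀ ∈ R'`
  have hd2mem : (d : K) ^ 2 / (x₀ : K) ^ 2 ∈ R' := by
    have heq : (d : K) ^ 2 / (x₀ : K) ^ 2 =
        s' ^ 2 * (x / x₀) ^ 2 - ((l₁ : K) / x₀) * ((l₂ : K) / x₀) - (x₀ : K) * ((c : K) / (x₀ : K) ^ 3) := by
      rw [hd2]
      field_simp
    rw [heq]
    exact sub_mem (sub_mem (mul_mem hs' (pow_mem hex 2)) (mul_mem (hv0 ▸ (v 0).2) (hv1 ▸ (v 1).2)))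
      (mul_mem (hRR₁ x₀.2) hr₃)
  have hdm : d ∈ maximalIdeal R := by
    have hxa : (x₀ : K) ^ 2 * ((d : K) ^ 2 / (x₀ : K) ^ 2) ∈ R := by
      rw [mul_div_cancel₀ _ (pow_ne_zero 2 hx₀K)]
      exact pow_mem d.2 2
    have h := QuadraticStep.mul_pow_mem_maximalIdeal_pow hQT hdom x₀.2 hvx₀ hd2mem 2 hxa
    have heq : (⟨(x₀ : K) ^ 2 * ((d : K) ^ 2 / (x₀ : K) ^ 2), hxa⟩ : R) = d ^ 2 := by
      apply Subtype.ext
      show (x₀ : K) ^ 2 * ((d : K) ^ 2 / (x₀ : K) ^ 2) = ((d ^ 2 : R) : K)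
      rw [mul_div_cancel₀ _ (pow_ne_zero 2 hx₀K)]
      norm_cast
    rw [heq] at h
    exact Ideal.IsPrime.mem_of_pow_mem inferInstance 2 (Ideal.pow_le_self two_ne_zero h)
  have hdx : (d : K) / x₀ ∈ R' :=
    QuadraticStep.div_mem_of_isQuadraticTransformAlong hQT hdom x₀.2 hx₀K hvx₀ hmax' d.2 ((hval d).mp hdm)
  let dx : R' := ⟨(d : K) / x₀, hdx⟩
  -- the identity in `R'`: `f₁ · (x/x₀)² = (d/x₀)² + v₁ v₂ + x₀ · (c/x₀³)`
  have hident : f₁ * ex ^ 2 = dx ^ 2 + v 0 * v 1 + x₀' * r₃ := by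
    apply Subtype.ext
    show s' ^ 2 * (x / x₀) ^ 2 = ((dx ^ 2 + v 0 * v 1 + x₀' * r₃ : R') : K)
    push_cast
    rw [hv0, hv1, hx₀']
    show s' ^ 2 * (x / x₀) ^ 2 =
      ((d : K) / x₀) ^ 2 + (l₁ : K) / x₀ * ((l₂ : K) / x₀) + (x₀ : K) * ((c : K) / (x₀ : K) ^ 3)
    simp only [div_pow]
    rw [hd2]
    field_simp
    ring
  -- ### the cotangent derivation of `R'` and relation (R1)
  obtain ⟨δ, hδwd, hδadd, hδmul, hδmem, hδsq⟩ :=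
    CotangentDerivation.exists_cotangentDerivation (R := R') hperf'
  have hδsum : ∀ (w : Fin 4 → R'), δ (∑ i, w i) = ∑ i, δ (w i) :=
    fun w => map_sum (AddMonoidHom.mk' δ hδadd) w _
  obtain ⟨γ, hγ⟩ := hnext
  have hδf₁ : δ f₁ = 0 := by
    have h1 : f₁ - γ ^ 2 ∈ maximalIdeal R' := Ideal.pow_le_self two_ne_zero hγ
    rw [hδwd f₁ γ h1, Ideal.toCotangent_eq_zero]
    exact hγ
  let vbar : Fin 4 → ResidueField R' := fun j => residue R' (v j)
  -- (R1): `v̄₁ • δ v₀ + v̄₀ • δ v₁ + r̄₃ • δ x₀ = 0`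
  have hR1 : vbar 1 • δ (v 0) + vbar 0 • δ (v 1) + residue R' r₃ • δ x₀' = 0 := by
    have hl0 : δ (f₁ * ex ^ 2) = 0 := by
      rw [hδmul, hδsq, hδf₁, smul_zero, smul_zero, add_zero]
    rw [hident, hδadd, hδadd, hδsq, zero_add, hδmul, hδmul x₀' r₃, hres0, zero_smul, zero_add] at hl0
    rw [← hl0]
    simp only [vbar]
    abel
  -- ### relation (R0) from `x₀ = Σ c_j l_j + m₂`
  set L₀ : Submodule (ResidueField R') (CotangentSpace R') :=
    Submodule.span (ResidueField R') {δ x₀'} with hL₀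
  have hold : ∀ r : R, δ (Subring.inclusion hRR₁ r) ∈ L₀ := fun r =>
    RankFourExit.delta_inclusion_mem_span hQT hdom hperf x₀ hx₀m hx₀0 hx₀max x₀' hx₀' δ hδadd hδmul hδsq r
  obtain ⟨cc, hcc, -⟩ := CotangentQuadratic.exists_coords u hu x₀ hx₀m
  set m₂ : R := x₀ - ∑ j, cc j * (u j : R) with hm₂
  have hr₂ : (m₂ : K) / (x₀ : K) ^ 2 ∈ R' := hB (QuadraticStep.div_pow_mem_blowupRing x₀ hcc)
  let r₂ : R' := ⟨(m₂ : K) / (x₀ : K) ^ 2, hr₂⟩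
  have hone : (1 : R') = ∑ j, Subring.inclusion hRR₁ (cc j) * v j + x₀' * r₂ := by
    apply Subtype.ext
    show (1 : K) = ((∑ j, Subring.inclusion hRR₁ (cc j) * v j + x₀' * r₂ : R') : K)
    push_cast
    simp only [hv, hx₀']
    show (1 : K) = ∑ j, ((cc j : R) : K) * ((u j : R) / (x₀ : K)) + (x₀ : K) * ((m₂ : K) / (x₀ : K) ^ 2)
    rw [hm₂]
    push_cast
    have e1 : ∀ j, ((cc j : R) : K) * ((u j : R) / (x₀ : K)) = ((cc j : R) : K) * (u j : R) / (x₀ : K) :=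
      fun j => by field_simp
    simp only [e1, ← Finset.sum_div]
    field_simp
    ring
  have hcbar1 : ∑ j, ψ (cc j) * vbar j = 1 := by
    have := congrArg (residue R') hone
    rw [map_one, map_add, map_sum, map_mul, hres0, zero_mul, add_zero] at this
    rw [this]
    exact Finset.sum_congr rfl fun j _ => by simp only [ψ, vbar, map_mul, RingHom.comp_apply]
  have hcbar : (fun j => ψ (cc j)) ≠ 0 := by
    intro h0
    apply QuadraticStep.not_mem_sq_of_forall_valuation_le hdom hx₀K hx₀max
    have hcm : ∀ j, cc j ∈ maximalIdeal R := fun j => hψ _ (congr_fun h0 j)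
    have : x₀ = m₂ + ∑ j, cc j * (u j : R) := by rw [hm₂]; ring
    rw [this, pow_two]
    refine add_mem (by rw [← pow_two]; exact hcc) (Ideal.sum_mem _ fun j _ => ?_)
    exact Ideal.mul_mem_mul (hcm j) (u j).2
  have hR0mem : ∑ j, ψ (cc j) • δ (v j) ∈ L₀ := by
    have h0 : δ (∑ j, Subring.inclusion hRR₁ (cc j) * v j + x₀' * r₂) = 0 := by
      rw [← hone]; simpa using hδsq 1
    rw [hδadd, hδsum, hδmul x₀' r₂, hres0, zero_smul, zero_add] at h0
    simp_rw [hδmul] at h0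
    rw [Finset.sum_add_distrib] at h0
    have hsum : ∑ j, ψ (cc j) • δ (v j) =
        -(∑ j, residue R' (v j) • δ (Subring.inclusion hRR₁ (cc j)) + residue R' r₂ • δ x₀') := by
      rw [eq_neg_iff_add_eq_zero, ← add_assoc]
      exact h0
    rw [hsum]
    exact L₀.neg_mem (add_mem (Submodule.sum_mem _ fun j _ => Submodule.smul_mem _ _ (hold (cc j)))
      (Submodule.smul_mem _ _ (Submodule.mem_span_singleton_self _)))
  obtain ⟨t₀, ht₀⟩ := Submodule.mem_span_singleton.mp hR0mem
  -- ### the span, the relation count, and `t = 0`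
  have hspanδ := RankFourExit.span_delta_eq_top hQT hdom hperf x₀ hx₀m hx₀0 hx₀max hR₁ x₀' hx₀' u hu v hv
    δ hδadd hδmul hδmem hδsq
  let E : Fin 4 → ResidueField R' := ![vbar 1, vbar 0, 0, 0]
  have hEsum : ∑ j, E j • δ (v j) = vbar 1 • δ (v 0) + vbar 0 • δ (v 1) := by
    simp [E, Fin.sum_univ_four]
  obtain ⟨t, ht⟩ := CotangentDerivation.exists_smul_of_two_relations (V := CotangentSpace R') h4'
    (δ x₀') (fun j => δ (v j)) hspanδ (fun j => ψ (cc j)) (-t₀) hcbar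
    (by rw [neg_smul, ht₀, add_neg_cancel]) E (residue R' r₃) (by rw [hEsum]; exact hR1)
  have ht0 : t = 0 := by
    have hself : ∑ k, E k * vbar k = 0 := by
      simp only [E, Fin.sum_univ_four, Matrix.cons_val_zero, Matrix.cons_val_one,
        Matrix.cons_val, zero_mul, add_zero]
      linear_combination (vbar 0 * vbar 1) * h2κ
    have htt : ∑ k, E k * vbar k = t := by
      calc ∑ k, E k * vbar k = t * ∑ k, ψ (cc k) * vbar k := by
            rw [Finset.mul_sum]
            exact Finset.sum_congr rfl fun k _ => by rw [ht k]; ring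
        _ = t := by rw [hcbar1, mul_one]
    rw [← htt, hself]
  -- ### conclusion: `v̄₀ = v̄₁ = 0`, i.e. `l₁/x₀, l₂/x₀ ∈ 𝔪'`, then change `x₀` to `x`
  have hv1bar : vbar 1 = 0 := by
    have := ht 0
    rw [ht0, zero_mul] at this
    simpa [E] using this
  have hv0bar : vbar 0 = 0 := by
    have := ht 1
    rw [ht0, zero_mul] at this
    simpa [E] using this
  have hv0m : v 0 ∈ maximalIdeal R' := (residue_eq_zero_iff _).mp hv0bar
  have hv1m : v 1 ∈ maximalIdeal R' := (residue_eq_zero_iff _).mp hv1bar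
  -- `x₀ / x ∈ R'` (`x` and `x₀` have the same, least, value)
  have hx₀x : (x₀ : K) / x ∈ R' :=
    QuadraticStep.div_mem_of_isQuadraticTransformAlong hQT hdom hxR hx0 hvx hxmax x₀.2 hvx₀
  have h₁ : (l₁ : K) / x ∈ R' :=
    QuadraticStep.div_mem_of_isQuadraticTransformAlong hQT hdom hxR hx0 hvx hxmax l₁.2 ((hval l₁).mp hl₁)
  have h₂ : (l₂ : K) / x ∈ R' :=
    QuadraticStep.div_mem_of_isQuadraticTransformAlong hQT hdom hxR hx0 hvx hxmax l₂.2 ((hval l₂).mp hl₂)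
  refine ⟨h₁, h₂, ?_, ?_⟩
  · have heq : (⟨(l₁ : K) / x, h₁⟩ : R') = v 0 * ⟨(x₀ : K) / x, hx₀x⟩ := by
      apply Subtype.ext
      show (l₁ : K) / x = (v 0 : K) * ((x₀ : K) / x)
      rw [hv0]
      field_simp
    rw [heq]
    exact Ideal.mul_mem_right _ _ hv0m
  · have heq : (⟨(l₂ : K) / x, h₂⟩ : R') = v 1 * ⟨(x₀ : K) / x, hx₀x⟩ := by
      apply Subtype.ext
      show (l₂ : K) / x = (v 1 : K) * ((x₀ : K) / x)
      rw [hv1]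
      field_simp
    rw [heq]
    exact Ideal.mul_mem_right _ _ hv1m

end Summit.ResolutionOfSingularities.ResolutionOfSingularities.Theorems.SwitchingDichotomy.CriticalSurface

end
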